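import Literature.NumberTheory.ComplexMultiplication.FaltingsTateOfInequivalentCMTypes
import Summits.HodgeConjecture.HodgeConjecture.Theorems.HCCMUnconditionalShimuraThm18_6Holds
import HarnessLib

/-!
# T5 (N6c) — [Fal83 §5 Kor. 1] for finite products of CM abelian varieties of pairwise INEQUIVALENT primitive types, UNCONDITIONALLY

Cell hodgecm-mathlib, fan A, binder hLiu418 (item stmt-HodgeConjecture-24832), sub-skeleton
`Cruxes/HLiu418/Lines/faltings_isogeny.lean` (row VI-1 = the floor binder
`hFal : ∀ {K} [Field K] (A B : AbelianVariety K) ℓ [Fact ℓ.Prime], faltings_tate_bijective A B ℓ`; T5 ledger row (N6c),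
A-plan1 g8).  The Literature heads of `Literature.NumberTheory.ComplexMultiplication.FaltingsTateOfInequivalentCMTypes`
prove, granted the named fact `shimura1998_thm18_6` ([Shimura 1998, Thm. 18.6]), that for finitely many structures
`(A_i, ι_i)` of PRIMITIVE CM types `(K_i, Φ_i)` over one number field `k ⊆ ℂ` (any dimensions) whose types are pairwise
`Aut`-INEQUIVALENT (no field isomorphism `θ : K_i ≃ K_{i'}` with `inducedCMType θ Φ_i = Φ_{i'}` — the same CM field is
allowed), the Tate map `ℤ_ℓ ⊗ Hom_k(A, B) → Hom_{Γ_k}(T_ℓ A, T_ℓ B)` is bijective for every `A ~ ⨁_s A_{c(s)}`,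
`B ~ ⨁_t A_{d(t)}` ([Shimura 1998, §13.1 (7) read both ways at one completely split prime]); that fact is a THEOREM of the
tree Summits-side (`Theorems.shimura1998_thm18_6_holds`, row II-1), so here the VI-1 TEXT ITSELF is decided with NO
hypothesis on this family — extending ★ `HLiu418FaltingsTateOfPrimitiveCMProducts` (pairwise non-isomorphic fields).
Witness rung («distance ledger»); no floor change, books 0.

HC_CM is proved only modulo the printed citations of the floor until rung 0 closes; this file moves no floor binder.
-/

-- mandated namespace `Summit.HodgeConjecture.HodgeConjecture.Theorems` trips `linter.dupNamespace` (single-problem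
-- summit); off as in `HCCMUnconditionalShimuraThm18_6Holds.lean`.
set_option linter.dupNamespace false

open CategoryTheory CategoryTheory.Limits NumberField Polynomial
open scoped NumberField IntermediateField

namespace Summit.HodgeConjecture.HodgeConjecture.Theorems

open Literature.AlgebraicGeometry.Motives
open Literature.NumberTheory.ComplexMultiplication

/-- **ONE place decides all pairs, unconditionally**: for finitely many structures `(A_i, ι_i)` of PRIMITIVE CM types
`(K_i, Φ_i)` over a number field `k ⊆ ℂ` and a prime `ℓ`, some `σ₀ ∈ Γ_k` acts on every `T_ℓ A_i` as `T_ℓ(ι_i π_i)` with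
`ℚ(π_i) = K_i`, and for all `i, i'` either `minpoly(π_i)(π_{i'}) ≠ 0` or the types are equivalent through a field
isomorphism `θ : K_i ≃ K_{i'}` — the Literature head fed with the tree's theorem `shimura1998_thm18_6_holds`.
[cite: Shimura1998, §13.1 (7) and Theorem 1 (ii), §13.2 Theorem 2 (proof), §18.6 Theorem 18.6] -/
theorem exists_common_tateRep_eq_and_aeval_ne_zero_or_inducedCMType_eq_of_primitive_CM_family
    {k : Type} [Field k] [NumberField k] [Algebra k ℂ] {ι : Type} [Finite ι]
    {K : ι → Type} [∀ i, Field (K i)] [∀ i, NumberField (K i)] [∀ i, IsCMField (K i)]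
    (Φ : ∀ i, CMType (K i)) (A : ι → AbelianVariety k) (ιA : ∀ i, 𝓞 (K i) →+* End (A i))
    (hA : ∀ i, IsCMTypeRealisationOver (Φ i) (A i) (ιA i)) {φ₀ : ∀ i, K i →+* ℂ}
    (hprim : ∀ i, IsPrimitive (ℂ ≃+* ℂ) (Φ i).1 (φ₀ i)) (ℓ : ℕ) [Fact ℓ.Prime] :
    ∃ (σ₀ : Field.absoluteGaloisGroup k) (π : ∀ i, 𝓞 (K i)),
      (∀ i, (A i).tateRep ℓ σ₀ = AbelianVariety.tateModuleMap ℓ (ιA i (π i) : A i ⟶ A i) ∧ ℚ⟮(π i : K i)⟯ = ⊤) ∧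
      ∀ i i', aeval (π i') (minpoly ℤ (π i)) ≠ 0 ∨
        ∃ θ : K i ≃+* K i', inducedCMType (θ : K i →+* K i') (Φ i) = Φ i' :=
  exists_common_tateRep_eq_and_aeval_ne_zero_or_inducedCMType_eq shimura1998_thm18_6_holds Φ A ιA hA hprim ℓ

/-- **[Faltings 1983, §5 Kor. 1] on the isogeny classes of finite products (with multiplicities) of PRIMITIVE CM
structures with pairwise INEQUIVALENT types, every dimension, unconditionally**: if no field isomorphism
`θ : K_i ≃ K_{i'}` (`i ≠ i'`) carries `Φ_i` to `Φ_{i'}`, then for index maps `c : S → ι`, `d : T → ι`, every `A`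
`k`-isogenous to `⨁_s A_{c s}`, every `B` `k`-isogenous to `⨁_t A_{d t}` and every prime `ℓ`, `faltings_tate_bijective A B ℓ`.
[cite: Faltings1983Endlichkeit, §5 Korollar 1] [cite: Shimura1998, §13.1 (7), §13.2 Theorem 2 and §18.6 Theorem 18.6] -/
theorem faltings_tate_bijective_of_isIsogenous_biproduct_of_inequivalent_primitive_CM_family
    {k : Type} [Field k] [Algebra k ℂ] {ι : Type} [Finite ι]
    {K : ι → Type} [∀ i, Field (K i)] [∀ i, NumberField (K i)] [∀ i, IsCMField (K i)]
    (Φ : ∀ i, CMType (K i)) (A : ι → AbelianVariety k) (ιA : ∀ i, 𝓞 (K i) →+* End (A i))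
    (hA : ∀ i, IsCMTypeRealisationOver (Φ i) (A i) (ιA i)) {φ₀ : ∀ i, K i →+* ℂ}
    (hprim : ∀ i, IsPrimitive (ℂ ≃+* ℂ) (Φ i).1 (φ₀ i))
    (hK : ∀ i i', i ≠ i' → ∀ θ : K i ≃+* K i', inducedCMType (θ : K i →+* K i') (Φ i) ≠ Φ i')
    {S T : Type} [Fintype S] [Fintype T] (c : S → ι) (d : T → ι) {A' B' : AbelianVariety k}
    (hA' : AbelianVariety.IsIsogenous (⨁ fun s => A (c s)) A')
    (hB' : AbelianVariety.IsIsogenous (⨁ fun t => A (d t)) B') (ℓ : ℕ) [Fact ℓ.Prime] :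
    faltings_tate_bijective A' B' ℓ := by
  intro hk
  exact faltings_tate_bijective_of_isIsogenous_biproduct_of_inducedCMType_ne shimura1998_thm18_6_holds Φ A ιA hA
    hprim hK ℓ c d hA' hB'

/-- **The single pair**: two structures of PRIMITIVE types among the family, `faltings_tate_bijective (A i) (A i') ℓ`
for all `i, i'`, unconditionally (diagonal: `ι(K)` is its own commutant; off the diagonal both Tate sides vanish).
[cite: Faltings1983Endlichkeit, §5 Korollar 1] [cite: SerreTate1968, §4 Theorem 5 and Corollary 1]
[cite: Shimura1998, §13.1 (7), §13.2 Theorem 2 and §18.6 Theorem 18.6] -/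
theorem faltings_tate_bijective_of_inequivalent_primitive_CM_family
    {k : Type} [Field k] [Algebra k ℂ] {ι : Type} [Finite ι]
    {K : ι → Type} [∀ i, Field (K i)] [∀ i, NumberField (K i)] [∀ i, IsCMField (K i)]
    (Φ : ∀ i, CMType (K i)) (A : ι → AbelianVariety k) (ιA : ∀ i, 𝓞 (K i) →+* End (A i))
    (hA : ∀ i, IsCMTypeRealisationOver (Φ i) (A i) (ιA i)) {φ₀ : ∀ i, K i →+* ℂ}
    (hprim : ∀ i, IsPrimitive (ℂ ≃+* ℂ) (Φ i).1 (φ₀ i))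
    (hK : ∀ i i', i ≠ i' → ∀ θ : K i ≃+* K i', inducedCMType (θ : K i →+* K i') (Φ i) ≠ Φ i')
    (ℓ : ℕ) [Fact ℓ.Prime] (i i' : ι) : faltings_tate_bijective (A i) (A i') ℓ := by
  intro hk
  exact faltings_tate_bijective_of_isPrimitive_of_inducedCMType_ne shimura1998_thm18_6_holds Φ A ιA hA hprim hK ℓ
    i i'

end Summit.HodgeConjecture.HodgeConjecture.Theorems
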